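/-
Origin: expansion seat `prover-pub-hodgecm-mc-binder-2-g16-0`, handover #87 2026-08-20T18:42Z md5 364c962b428e (NEW; 57 l.; 2 theorems: `HodgeCM.SignRecipe.horbit_of_isNormalClosure` (for `L` a normal closure over `ℚ` every complex embedding of `L` is `ι₁ ∘ g`, `g ∈ Aut(L)` — via `CMTypeOps.isGaloisRat_of_isNormalClosure` + `CMTypeOps.exists_eq_comp`) and `HodgeCM.Model.SInstance.exists_posImSet_imagUnit_mul_of_GOG_of_scope` (= #83's `…_of_orbit` with its `horbit` input DISCHARGED at `U.PerL`'s scope: under the OG guard `{τ ∣ 0 < Im τ(δ_L a_i)} = liftType false …`, `{… < 0}` = its conjugate, all four `i`). CERT lean-direct over the PKG oleans (mirror = RUN 56 as landed; both imports unchanged in RUNS 57–58): rc 0 ∕ 5 s ∕ 0 warn ∕ proof holes 0; `#print axioms` 2 ∕ 2 trio (`g16/certs/axioms-scope-r58.log`); FQN scan 0 collisions; NAME LIST: `HodgeCM.Model.SInstance.exists_posImSet_imagUnit_mul_of_GOG_of_scope` · `HodgeCM.SignRecipe.horbit_of_isNormalClosure`) (`HOME/mc/pub-hodgecm-mc-binder-2/g16/stage59/HodgeCM/Model/HypCensus/JLiuDeltaSignScope.lean`,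 md5 364c962b428e, 57 lines);
landed by the gen-24 packager (p-g24) in gate run 59 as `HodgeCM/Model/HypCensus/JLiuDeltaSignScope.lean` (verbatim).
-/
/-
Origin: speedrun cell pub-hodgecm, MODEL-CONSTRUCTION sub-cell, unit pub-hodgecm-mc-binder-2-g16 (BINDER PROVER, gen 16), seat prover-pub-hodgecm-mc-binder-2-g16-0,
2026-08-20.  Target in PKG: HodgeCM/Model/HypCensus/JLiuDeltaSignScope.lean (NEW additive leaf; imports binder-2's RUN-56 #83 `HypCensus/JLiuDeltaSign` and
`HodgeCM.CM.ReflexInflate` only; nothing imports it).  KERNEL ONLY, proof holes: 0; MODEL-N ±0; E untouched.  Nothing here is a claim of the manuscripts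
under adjudication.
-/
import Summits.HodgeConjecture.HodgeCM.Model.HypCensus.JLiuDeltaSign
import Summits.HodgeConjecture.HodgeCM.CM.ReflexInflate

set_option autoImplicit false

/-!
# #83's orbit hypothesis at PerL's scope

The `_of_orbit` lemmas of `HypCensus/JLiuDeltaSign` take `horbit : ∀ τ : L →+* ℂ, ∃ g : L ≃+* L, ι₁ ∘ g = τ` (every complex embedding of `L`
is an `Aut(L)`-translate of `ι₁`).  At `U.PerL`'s scope this is automatic: `IsNormalClosure ℚ K L ⇒ L/ℚ` Galois
(`CMTypeOps.isGaloisRat_of_isNormalClosure`) ⇒ `CMTypeOps.exists_eq_comp`.  Hence the bit-free read-off of Liu's admissibility sets under the OG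
guard holds at every PerL context with no orbit input.
-/

noncomputable section

open Literature.NumberTheory.GelbartRogawski1991.UnitaryDualPair (imagUnit)

namespace HodgeCM

namespace SignRecipe

/-- **The orbit hypothesis from PerL's scope**: for `L` a normal closure of `K` over `ℚ`, every complex embedding of `L` is `ι₁ ∘ g` for some
`g ∈ Aut(L)`. [folklore] -/
theorem horbit_of_isNormalClosure {K L : CMField} (hN : IsNormalClosure ℚ K L) (ι₁ : L →+* ℂ) :
    ∀ τ : L →+* ℂ, ∃ g : L ≃+* L, ι₁.comp g.toRingHom = τ := fun τ => by
  obtain ⟨g, hg⟩ := CMTypeOps.exists_eq_comp (CMTypeOps.isGaloisRat_of_isNormalClosure hN) ι₁ τ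
  exact ⟨g, hg.symm⟩

end SignRecipe

namespace Model.SInstance

open HodgeCM.SignRecipe HodgeCM.CMTypeOps

variable {K L : CMField} {ι₁ : L →+* ℂ} (V : HermSpace3 L ι₁) (c : SeesawCtx L)

/-- **Liu's admissibility sets under the OG guard AT PerL's SCOPE, bit-free**: for `L` a normal closure (of any `K`) the `horbit` input of
`exists_posImSet_imagUnit_mul_of_GOG_of_orbit` is discharged — `{τ ∣ 0 < Im τ(δ_L a_i)} = Φ_{Ψ_i}^{(false)}` (Shimura's `S*`-type of the corner)
and `{τ ∣ Im τ(δ_L a_i) < 0}` = its conjugate, for all four `i`. [folklore] -/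
theorem exists_posImSet_imagUnit_mul_of_GOG_of_scope (hN : IsNormalClosure ℚ K L) (hc : GOG V c) :
    ∃ j : c.K →+* L, ι₁.comp j = c.σ ∧ ∀ i : Fin 4,
      {τ : L →+* ℂ | 0 < (τ (imagUnit (L : Type) * c.D.a i)).im} = (liftType false c.K L j ι₁ (c.Ψ i)).1 ∧
      {τ : L →+* ℂ | (τ (imagUnit (L : Type) * c.D.a i)).im < 0} = (bar (liftType false c.K L j ι₁ (c.Ψ i))).1 :=
  exists_posImSet_imagUnit_mul_of_GOG_of_orbit V c hc (horbit_of_isNormalClosure hN ι₁)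

end Model.SInstance

end HodgeCM

end
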